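import Mathlib.Topology.Order.MonotoneConvergence
import Mathlib.Topology.MetricSpace.Pseudo.Lemmas
import Mathlib.Analysis.SpecificLimits.Basic
import Mathlib.Topology.Order.IntermediateValue

/-!
# Stub F (`besovFloorBound`) for `PerpetualPump.Thesis`, part II: the real-variable bootstrap

Support file (part 2 of the stub `besovFloorBound` of line `SketchIdeator2`, crux
stmt-NavierStokesRegularity-1832): the three real-variable lemmas through which the two a-priori
estimates of the `Ḃ⁰_{∞,1}` floor argument (the Besov Duhamel inequality and the tame `H¹⁰`
Duhamel inequality, see part III `…BesovFloorBoundReduction`) are turned into global bounds on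
`[t₀, T)`:

* `F.bootstrap_lt` — **continuity bootstrap** on a half-open interval: a continuous `β` with
  `β t₀ < K` that improves to `β t ≤ q < K` whenever `β < K` on `[t₀,t]` stays `< K` on `[t₀,T)`;
* `F.le_two_mul_of_step` — **halving iteration**: if every bound `η ≤ R` on `[t₁,t₂]` improves to
  `η ≤ η t₁ + R/2`, then `η ≤ 2 η t₁` there;
* `F.le_two_pow_mul_of_local` — **short steps**: `η s ≤ 2 η t₁` on windows of length `δ` gives
  `η ≤ 2ⁿ η t₀` on `[t₀, t₀ + nδ]`.

(The registered sub-goal `stub_besovFloorBound_Boot` is the first of these.)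
-/

open Set Filter Topology

set_option linter.dupNamespace false

namespace Summit.NavierStokesRegularity.NavierStokesRegularity.Theorems.PerpetualPumpThesis.F

/-- **Continuity bootstrap on a half-open interval.** Let `β` be continuous on `[t₀,T)` with
`β t₀ < K`, and suppose that whenever `β < K` on `[t₀,t]` one has the improved bound `β t ≤ q`,
where `q < K`. Then `β < K` on `[t₀,T)`: at the first bad time `s₁ > t₀` the improved bound
holds on `[t₀,s₁)` and passes to the limit. -/
theorem bootstrap_lt {β : ℝ → ℝ} {t₀ T K q : ℝ} (hcont : ContinuousOn β (Ico t₀ T))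
    (h0 : β t₀ < K) (hq : q < K)
    (hstep : ∀ t ∈ Ico t₀ T, (∀ s ∈ Icc t₀ t, β s < K) → β t ≤ q) :
    ∀ t ∈ Ico t₀ T, β t < K := by
  intro tb htb
  by_contra hbad
  rw [not_lt] at hbad
  set S : Set ℝ := Icc t₀ tb ∩ β ⁻¹' (Ici K) with hS
  have hsub : Icc t₀ tb ⊆ Ico t₀ T := fun s hs => ⟨hs.1, hs.2.trans_lt htb.2⟩
  have hSclosed : IsClosed S :=
    (hcont.mono hsub).preimage_isClosed_of_isClosed isClosed_Icc isClosed_Ici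
  have hSne : S.Nonempty := ⟨tb, ⟨htb.1, le_rfl⟩, hbad⟩
  have hSbdd : BddBelow S := ⟨t₀, fun s hs => hs.1.1⟩
  have hs₁S : sInf S ∈ S := hSclosed.csInf_mem hSne hSbdd
  set s₁ : ℝ := sInf S with hs₁
  have hKs₁ : K ≤ β s₁ := hs₁S.2
  have hs₁I : s₁ ∈ Icc t₀ tb := hs₁S.1
  have ht₀s₁ : t₀ < s₁ := by
    rcases eq_or_lt_of_le hs₁I.1 with h | h
    · rw [← h] at hKs₁
      exact absurd h0 (not_lt.2 hKs₁)
    · exact h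
  -- below `s₁` the bound `β < K` holds, hence the improved bound
  have hbelow : ∀ s ∈ Ico t₀ s₁, β s < K := by
    intro s hs
    by_contra h'
    rw [not_lt] at h'
    have hsS : s ∈ S := ⟨⟨hs.1, hs.2.le.trans hs₁I.2⟩, h'⟩
    exact absurd (csInf_le hSbdd hsS) (not_le.2 hs.2)
  have hq' : ∀ t ∈ Ico t₀ s₁, β t ≤ q := fun t ht =>
    hstep t ⟨ht.1, (ht.2.trans_le hs₁I.2).trans htb.2⟩
      fun s hs => hbelow s ⟨hs.1, hs.2.trans_lt ht.2⟩
  -- pass to the limit `t → s₁⁻`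
  have hcw : ContinuousWithinAt β (Ico t₀ s₁) s₁ :=
    (hcont s₁ ⟨hs₁I.1, hs₁I.2.trans_lt htb.2⟩).mono
      fun s hs => ⟨hs.1, (hs.2.trans_le hs₁I.2).trans htb.2⟩
  haveI : (𝓝[Ico t₀ s₁] s₁).NeBot := by
    refine mem_closure_iff_nhdsWithin_neBot.1 ?_
    rw [closure_Ico ht₀s₁.ne]
    exact right_mem_Icc.2 ht₀s₁.le
  have hlim : β s₁ ≤ q := le_of_tendsto hcw (eventually_nhdsWithin_of_forall hq')
  exact absurd (hlim.trans_lt hq) (not_lt.2 hKs₁)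

/-- **Halving iteration.** If `η ≥ 0` at `t₁`, `η ≤ R₀` on `[t₁,t₂]` with `0 ≤ R₀`, and every
bound `η ≤ R` (`R ≥ 0`) on `[t₁,t₂]` improves to `η ≤ η t₁ + R/2` there, then `η ≤ 2 η t₁` on
`[t₁,t₂]` (`η ≤ 2η t₁ + R₀ 2^{-k}` for every `k`). -/
theorem le_two_mul_of_step {η : ℝ → ℝ} {t₁ t₂ R₀ : ℝ} (h0 : 0 ≤ η t₁) (hR₀0 : 0 ≤ R₀)
    (hR₀ : ∀ s ∈ Icc t₁ t₂, η s ≤ R₀)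
    (hstep : ∀ R : ℝ, 0 ≤ R → (∀ s ∈ Icc t₁ t₂, η s ≤ R) →
      ∀ s ∈ Icc t₁ t₂, η s ≤ η t₁ + R / 2) :
    ∀ s ∈ Icc t₁ t₂, η s ≤ 2 * η t₁ := by
  have hk : ∀ k : ℕ, ∀ s ∈ Icc t₁ t₂, η s ≤ 2 * η t₁ + R₀ / 2 ^ k := by
    intro k
    induction k with
    | zero =>
        intro s hs
        rw [pow_zero, div_one]
        linarith [hR₀ s hs]
    | succ k ih =>
        intro s hs
        have hR : 0 ≤ 2 * η t₁ + R₀ / 2 ^ k := by positivity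
        calc η s ≤ η t₁ + (2 * η t₁ + R₀ / 2 ^ k) / 2 := hstep _ hR ih s hs
          _ = 2 * η t₁ + R₀ / 2 ^ (k + 1) := by rw [pow_succ]; ring
  intro s hs
  have hlim : Tendsto (fun k : ℕ => 2 * η t₁ + R₀ / 2 ^ k) atTop (𝓝 (2 * η t₁)) := by
    have h1 : Tendsto (fun k : ℕ => R₀ * (2⁻¹ : ℝ) ^ k) atTop (𝓝 (R₀ * 0)) :=
      (tendsto_pow_atTop_nhds_zero_of_lt_one (by norm_num) (by norm_num)).const_mul R₀
    rw [mul_zero] at h1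
    have h2 := h1.const_add (2 * η t₁)
    rw [add_zero] at h2
    refine h2.congr fun k => ?_
    rw [inv_pow, div_eq_mul_inv]
  exact ge_of_tendsto' hlim fun k => hk k s hs

/-- **Short-step iteration.** If `0 ≤ η t₀` and `η s ≤ 2 η t₁` whenever
`t₀ ≤ t₁ ≤ s ≤ t₁ + δ`, `s < T` (`δ > 0`), then `η s ≤ 2ⁿ η t₀` for `s ∈ [t₀, t₀ + nδ]`, `s < T`. -/
theorem le_two_pow_mul_of_local {η : ℝ → ℝ} {t₀ T δ : ℝ} (hδ : 0 < δ) (h0 : 0 ≤ η t₀)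
    (hloc : ∀ t₁ ∈ Ico t₀ T, ∀ s ∈ Ico t₀ T, t₁ ≤ s → s ≤ t₁ + δ → η s ≤ 2 * η t₁) :
    ∀ n : ℕ, ∀ s ∈ Ico t₀ T, s ≤ t₀ + n * δ → η s ≤ 2 ^ n * η t₀ := by
  intro n
  induction n with
  | zero =>
      intro s hs hsn
      rw [Nat.cast_zero, zero_mul, add_zero] at hsn
      rw [le_antisymm hsn hs.1, pow_zero, one_mul]
  | succ n ih =>
      intro s hs hsn
      rcases le_or_gt s (t₀ + n * δ) with h | h
      · calc η s ≤ 2 ^ n * η t₀ := ih s hs h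
          _ ≤ 2 ^ (n + 1) * η t₀ := by
              rw [pow_succ]
              nlinarith [pow_pos (two_pos : (0 : ℝ) < 2) n]
      · have hn0 : (0 : ℝ) ≤ n * δ := by positivity
        have ht₁ : t₀ + n * δ ∈ Ico t₀ T := ⟨by linarith, h.trans hs.2⟩
        have hsδ : s ≤ t₀ + n * δ + δ := by
          rw [Nat.cast_succ] at hsn
          linarith
        calc η s ≤ 2 * η (t₀ + n * δ) := hloc _ ht₁ s hs h.le hsδ
          _ ≤ 2 * (2 ^ n * η t₀) := by
              gcongr
              exact ih _ ht₁ le_rfl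
          _ = 2 ^ (n + 1) * η t₀ := by rw [pow_succ]; ring

end Summit.NavierStokesRegularity.NavierStokesRegularity.Theorems.PerpetualPumpThesis.F

namespace Summit.NavierStokesRegularity.NavierStokesRegularity.Theorems.PerpetualPumpThesis

/-- **Part Boot of stub F (registered sub-goal `stub_besovFloorBound_Boot`)**: the continuity
bootstrap on a half-open interval `[t₀, T)` — a continuous real function `β` with `β t₀ < K`,
which satisfies the improved bound `β t ≤ q` (`q < K`) whenever `β < K` on `[t₀, t]`, stays below
`K` on all of `[t₀, T)`. -/
theorem stub_besovFloorBound_Boot : ∀ (β : ℝ → ℝ) (t₀ T K q : ℝ), ContinuousOn β (Ico t₀ T) → β t₀ < K → q < K → (∀ t ∈ Ico t₀ T, (∀ s ∈ Icc t₀ t, β s < K) → β t ≤ q) → ∀ t ∈ Ico t₀ T, β t < K :=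
  fun _ _ _ _ _ hcont h0 hq hstep => F.bootstrap_lt hcont h0 hq hstep

end Summit.NavierStokesRegularity.NavierStokesRegularity.Theorems.PerpetualPumpThesis
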